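import Mathlib
import HarnessLib

/-!
# Route `HolomorphicityRate`, crux `SuperThresholdRigidity` (stmt-HodgeConjecture-2737) — stub 2b

Submersivity is an open condition for `C¹` maps between finite-dimensional real normed spaces:
if `φ : E → F` is `C¹` at `a` and `dφ(a)` is onto, then `dφ(y)` is onto for every `y` near `a`.
Helper (`--supports stmt-HodgeConjecture-2737`) for the recognition half of the crux skeleton
`Cruxes/SuperThresholdRigidity/Lines/birth.lean` (stub `stub_eventually_surjective_fderiv`); Mathlib only.
-/

-- the problem path `HodgeConjecture/HodgeConjecture` (single-problem summit) repeats a namespace segment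
set_option linter.dupNamespace false

open Filter Topology

namespace Summit.HodgeConjecture.HodgeConjecture.Theorems

/-- **Submersivity is an open condition** (finite-dimensional real normed spaces). If `φ : E → F` is
`C¹` at `a` and the Fréchet derivative `dφ(a) = fderiv ℝ φ a` is onto, then `dφ(y)` is onto for all
`y` in a neighbourhood of `a`. Proof: `y ↦ dφ(y)` is continuous at `a` (`ContDiffAt.continuousAt_fderiv`);
for a continuous linear right inverse `B` of `dφ(a)` (finite dimension) the endomorphisms
`dφ(y) ∘ B` of `F` depend continuously on `y` and equal `1` at `y = a`, so they are units for `y` near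
`a` (units of the Banach algebra `F →L[ℝ] F` are open), whence `dφ(y)` is onto.
[LeeSmoothManifolds2013, Prop. 4.1] [folklore] -/
theorem stub_eventually_surjective_fderiv : ∀ {E F : Type*} [NormedAddCommGroup E] [NormedSpace ℝ E] [FiniteDimensional ℝ E] [NormedAddCommGroup F] [NormedSpace ℝ F] [FiniteDimensional ℝ F] {φ : E → F} {a : E}, ContDiffAt ℝ 1 φ a → Function.Surjective (fderiv ℝ φ a) → ∀ᶠ y in nhds a, Function.Surjective (fderiv ℝ φ y) := by
  intro E F _ _ _ _ _ _ φ a hφ ha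
  haveI : CompleteSpace F := FiniteDimensional.complete ℝ F
  -- a continuous linear right inverse `B` of the onto map `dφ(a)`
  obtain ⟨B, hB⟩ :=
    (fderiv ℝ φ a).exists_rightInverse_of_surjective (LinearMap.range_eq_top.2 ha)
  -- `y ↦ dφ(y)` is continuous at `a`, hence so is `y ↦ dφ(y) ∘ B : F →L[ℝ] F`
  have hcont : ContinuousAt (fderiv ℝ φ) a := hφ.continuousAt_fderiv one_ne_zero
  have hcomp : ContinuousAt (fun y => (fderiv ℝ φ y).comp B) a :=
    hcont.clm_comp continuousAt_const
  -- at `y = a` this endomorphism is the unit `1 = id`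
  have hunit : IsUnit ((fderiv ℝ φ a).comp B) := by
    rw [hB]
    exact isUnit_one
  -- units of the Banach algebra `F →L[ℝ] F` form an open set
  have hmem : ∀ᶠ y in 𝓝 a, IsUnit ((fderiv ℝ φ y).comp B) :=
    hcomp.preimage_mem_nhds (Units.isOpen.mem_nhds hunit)
  filter_upwards [hmem] with y hy
  obtain ⟨C, hC⟩ := hy.exists_right_inv
  rw [ContinuousLinearMap.mul_def, ContinuousLinearMap.one_def] at hC
  exact fun w => ⟨B (C w), DFunLike.congr_fun hC w⟩

end Summit.HodgeConjecture.HodgeConjecture.Theorems
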